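import Literature.AlgebraicGeometry.HodgeTheory.GAGADimension
import Literature.AlgebraicGeometry.HodgeTheory.HodgeFiltrationModelsReduction
import Literature.AlgebraicGeometry.HodgeTheory.LefschetzOneOneChowProofs
import Literature.Geometry.Kaehler.AnalyticSetBiholomorph
import Literature.Geometry.Kaehler.AnalyticSetRegularUnion
import HarnessLib

/-!
# Analytically supported cohomology classes on a Hodge model

Family `hodge`, layer `Literature/AlgebraicGeometry/HodgeTheory`. Consumer: route
`HolomorphicityRate` of the Hodge conjecture (items `Target`, `SuperThresholdRigidity`,
`AnalyticSupportAlgebraic` inline the predicate defined here verbatim).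

For a scheme `X/ℂ`, a Hodge model `A : HodgeModel n X` (a complex manifold `M = A.carrier ≅ X^an`
with its comparison map `φ : M → X(ℂ)`, file `RationalHodgeClasses`), `p : ℕ` and a class
`c ∈ Hᵏ(X(ℂ); ℂ) = complexBetti X k`:

* `IsAnalyticallySupported A p c` — **`c` is supported on a closed analytic subset of `X^an` of
  codimension `≥ p`**: there is a closed analytic `S ⊆ M` (`Literature.Geometry.Kaehler.IsAnalyticSet`)
  all of whose regular points have codimension `≥ p` (`regularLocus`, `IsRegularPointOfCodim`: the
  textbook "`dim S ≤ n - p`", the dimension of an analytic set being read at its smooth points,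
  Voisin I Def. 11.4–11.6) such that `φ^* c ∈ Hᵏ(M; ℂ)` restricts to `0` in `Hᵏ(M ∖ S; ℂ)`. This is
  the analytic counterpart of the algebraic support filtration `supportedClasses X k p = Nᵖ Hᵏ`
  (Zariski-closed supports; Grothendieck's coniveau), and the support formulation of the hypothesis
  of `lefschetzOneOne_rational_of` (`p = 1`, where "codimension `≥ 1`" is spelled `S ≠ univ`:
  `isAnalyticallySupported_one_iff`). The class of a closed analytic subset `Z` of codimension `r`
  is of this kind: it comes from `H^{2r}(X, X − Z)` (Voisin I, §11.1.2), so dies on `X − Z`.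
* `analyticallySupportedClasses A p k` — these classes form a `ℂ`-submodule (`0`: empty support;
  scalars: same support; sums: the UNION of the supports — the one non-formal point,
  `Literature.Geometry.Kaehler.forall_regularLocus_union_le`, file `Kaehler/AnalyticSetRegularUnion`:
  a regular point of `S ∪ S'` is a regular point of the same codimension of `S` or of `S'`, by the
  identity principle at a regular point).
* `IsAnalyticallySupported.mem_supportedClasses` — **analytically supported classes of a smooth
  projective variety are algebraically supported** (`→ c ∈ supportedClasses X k p`, hence
  `∈ algebraicClasses X p` for `k = 2p`), CONDITIONAL on the named fact
  `gaga_le_coheight_of_regularLocus_codim` (GAGA §6 Prop. 3 Cor. 2–3, file `GAGADimension`): Chow's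
  theorem for analytifications (`chow_analyticSet_analytification_holds`, proved; GAGA §19 Prop. 13)
  makes `S = φ⁻¹(Z(ℂ))` with `Z` Zariski-closed, GAGA gives `codim Z ≥ p`, and the vanishing is
  transported along `M ∖ S ≃ (X ∖ Z)(ℂ)` (`restrictCompl_eq_zero_of_pullback`) — the `p`-general
  form of the glue of `lefschetzOneOne_rational_of`; up to the GAGA hypothesis, the route item
  `AnalyticSupportAlgebraic`.
* `isAnalyticallySupported_independent_of_hodgeModel` — for `X` smooth projective the predicate
  does not depend on the Hodge model: two models are biholomorphic over `X(ℂ)`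
  (`HodgeModel.exists_biholomorph`, i.e. `IsAnalytification.unique_holds`, GAGA §2 n°5 Prop. 2), and
  supports, codimension bounds at regular points and the vanishing transport along biholomorphisms
  (`IsAnalyticallySupported.of_biholomorph`, file `Kaehler/AnalyticSetBiholomorph`).

Further API: `isAnalyticallySupported_iff` (unfolding), `IsAnalyticallySupported.anti`
(antitone in `p`), `isAnalyticallySupported_zero_left` (codimension `0` is everything, `S = M`),
`IsAnalyticallySupported.exists_ne_univ` / `isAnalyticallySupported_of_ne_univ` (the `p = 1`
dictionary; needs `M` non-empty, resp. connected — both hold for `X` smooth projective,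
`HodgeModel.connectedSpace_carrier`).

## Design

* The body of `IsAnalyticallySupported` is, up to bound-variable names, the inline text of the
  route items (`∃ S, (IsAnalyticSet ∧ ∀ x ∈ regularLocus, ∀ q, IsRegularPointOfCodim → p ≤ q) ∧
  map (Subtype.val) k (A.pullback k c) = 0`), so that `Iff.rfl` bridges the two.
* "Codimension `≥ p`" is imposed on REGULAR points only, as in the route text; for an analytic set
  this is `dim S ≤ dim M - p`, regular points being dense (`IsAnalyticSet.subset_closure_regularLocus_holds`)
  and the dimension being read on them (Voisin I, Def. 11.6; Chirka, §2.3). `S = ∅` is allowed.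

## What is NOT here

* The discharge of `gaga_le_coheight_of_regularLocus_codim` (GAGA §6 plus the dimension theory of
  analytic sets); with it `IsAnalyticallySupported.mem_algebraicClasses` becomes unconditional.
* The converse `supportedClasses X k p ≤ analyticallySupportedClasses A p k` (GAGA §5: `Z(ℂ)^h` is
  analytic, and the converse codimension inequality).

## References

* C. Voisin, *Hodge Theory and Complex Algebraic Geometry I* (CUP 2002), §11.1.1 (Def. 11.4–11.6),
  §11.1.2 (cohomology class of an analytic subset) [VoisinHodgeI2002].
* A. Grothendieck, *Hodge's general conjecture is false for trivial reasons*, Topology 8 (1969), §1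
  [GrothendieckTopology1969].
* J.-P. Serre, *Géométrie algébrique et géométrie analytique*, Ann. Inst. Fourier 6 (1956), §2 n°5
  Prop. 2, §5, §6 Prop. 3 Cor. 2–3, §19 Prop. 13 [SerreGAGA1956].
* W.-L. Chow, On compact complex analytic varieties, Amer. J. Math. 71 (1949), Thm. V [Chow1949].
* E. M. Chirka, *Complex Analytic Sets* (1989), §2.3, §5.3 [Chirka1989].
-/

noncomputable section

open scoped Manifold ContDiff Topology
open Set Filter CategoryTheory

namespace Literature.AlgebraicGeometry.HodgeTheory

section HodgeTheory

open Literature.AlgebraicTopology.SingularHomology Literature.Geometry.Kaehler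

variable {n : ℕ} {X : Motives.SchemeOver ℂ}

/-! ### The definition -/

/-- **Analytically supported classes.** For a Hodge model `A` of `X` (`M = A.carrier ≅ X^an`,
comparison `φ = A.toComplexPoints`), `p : ℕ` and `c ∈ Hᵏ(X(ℂ); ℂ)`:
`IsAnalyticallySupported A p c` means that there is a closed analytic subset `S ⊆ M`, all of whose
regular points have codimension `≥ p` ("`codim S ≥ p`", the dimension of an analytic set being that
of its manifold of smooth points, Voisin I Def. 11.4–11.6), such that `φ^* c` restricts to `0` in
`Hᵏ(M ∖ S; ℂ)` — `c` "is supported on `S`", as the class of an analytic cycle of codimension `p`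
is supported on the cycle (Voisin I, §11.1.2: `[Z]` comes from `H^{2p}(X, X − Z)`). The analytic
analogue of `supportedClasses X k p = Nᵖ Hᵏ` (Zariski-closed supports); verbatim the support
clause of the route items of `HolomorphicityRate`. `S = ∅` is allowed.
[cite: VoisinHodgeI2002, §11.1.1 Def. 11.4–11.6 and §11.1.2]
[cite: GrothendieckTopology1969, §1] -/
def IsAnalyticallySupported (A : HodgeModel n X) (p : ℕ) {k : ℕ} (c : complexBetti X k) : Prop :=
  ∃ S : Set A.carrier,
    (IsAnalyticSet 𝓘(ℂ, A.model) S ∧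
      ∀ x ∈ regularLocus 𝓘(ℂ, A.model) S, ∀ q : ℕ,
        IsRegularPointOfCodim 𝓘(ℂ, A.model) S q x → p ≤ q) ∧
    singularCohomology.map ℂ ℂ
      (⟨Subtype.val, continuous_subtype_val⟩ : C({x : A.carrier // x ∉ S}, A.carrier)) k
      (A.pullback k c) = 0

/-- Unfolding of `IsAnalyticallySupported` (by `Iff.rfl`; this is the inline text of the route
items `Target` / `SuperThresholdRigidity` / `AnalyticSupportAlgebraic` of `HolomorphicityRate`).
[cite: VoisinHodgeI2002, §11.1.2] -/
theorem isAnalyticallySupported_iff (A : HodgeModel n X) (p : ℕ) {k : ℕ} (c : complexBetti X k) :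
    IsAnalyticallySupported A p c ↔
      ∃ S : Set A.carrier,
        (IsAnalyticSet 𝓘(ℂ, A.model) S ∧
          ∀ x ∈ regularLocus 𝓘(ℂ, A.model) S, ∀ q : ℕ,
            IsRegularPointOfCodim 𝓘(ℂ, A.model) S q x → p ≤ q) ∧
        singularCohomology.map ℂ ℂ
          (⟨Subtype.val, continuous_subtype_val⟩ : C({x : A.carrier // x ∉ S}, A.carrier)) k
          (A.pullback k c) = 0 :=
  Iff.rfl

/-- If a class on `M` dies on `M ∖ S`, it dies on `M ∖ T` for every `T ⊇ S` (restrict further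
along `M ∖ T ↪ M ∖ S`). [folklore] -/
theorem HodgeModel.map_compl_eq_zero_of_subset (A : HodgeModel n X) {k : ℕ} {S T : Set A.carrier}
    (hST : S ⊆ T) (y : singularCohomology ℂ ℂ A.carrier k)
    (hy : singularCohomology.map ℂ ℂ
      (⟨Subtype.val, continuous_subtype_val⟩ : C({x : A.carrier // x ∉ S}, A.carrier)) k y = 0) :
    singularCohomology.map ℂ ℂ
      (⟨Subtype.val, continuous_subtype_val⟩ : C({x : A.carrier // x ∉ T}, A.carrier)) k y = 0 := by
  let j : C({x : A.carrier // x ∉ T}, {x : A.carrier // x ∉ S}) :=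
    ⟨fun x => ⟨x.1, fun h => x.2 (hST h)⟩, by fun_prop⟩
  have hcomp : (⟨Subtype.val, continuous_subtype_val⟩ : C({x : A.carrier // x ∉ T}, A.carrier)) =
      (⟨Subtype.val, continuous_subtype_val⟩ : C({x : A.carrier // x ∉ S}, A.carrier)).comp j := by
    ext x
    rfl
  rw [hcomp, singularCohomology.map_comp]
  change singularCohomology.map ℂ ℂ j k (singularCohomology.map ℂ ℂ
    (⟨Subtype.val, continuous_subtype_val⟩ : C({x : A.carrier // x ∉ S}, A.carrier)) k y) = 0
  rw [hy, map_zero]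

/-! ### Elementary API: antitonicity, `0`, scalars, sums; the submodule -/

/-- Support of codimension `≥ p` is support of codimension `≥ p'` for `p' ≤ p` (same support).
[cite: GrothendieckTopology1969, §1] -/
theorem IsAnalyticallySupported.anti {A : HodgeModel n X} {p p' : ℕ} {k : ℕ} {c : complexBetti X k}
    (hp : p' ≤ p) (h : IsAnalyticallySupported A p c) : IsAnalyticallySupported A p' c := by
  obtain ⟨S, ⟨hS, hSp⟩, hcS⟩ := h
  exact ⟨S, ⟨hS, fun x hx q hq => hp.trans (hSp x hx q hq)⟩, hcS⟩

/-- The zero class is analytically supported in every codimension (empty support).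
[cite: VoisinHodgeI2002, §11.1.2] -/
theorem IsAnalyticallySupported.zero (A : HodgeModel n X) (p k : ℕ) :
    IsAnalyticallySupported A p (0 : complexBetti X k) :=
  ⟨∅, ⟨isAnalyticSet_empty, fun x hx => absurd hx.1 (notMem_empty x)⟩, by rw [map_zero, map_zero]⟩

/-- Scalar multiples of an analytically supported class are analytically supported (same
support). [cite: VoisinHodgeI2002, §11.1.2] -/
theorem IsAnalyticallySupported.smul {A : HodgeModel n X} {p k : ℕ} {c : complexBetti X k}
    (h : IsAnalyticallySupported A p c) (a : ℂ) : IsAnalyticallySupported A p (a • c) := by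
  obtain ⟨S, hS, hcS⟩ := h
  exact ⟨S, hS, by rw [map_smul, map_smul, hcS, smul_zero]⟩

/-- **Sums of analytically supported classes are analytically supported**, on the union of the
supports: `S ∪ S'` is analytic (`IsAnalyticSet.union`), its regular points are regular points of
the same codimension of `S` or of `S'` (`forall_regularLocus_union_le`, by the identity principle
at a regular point), and both summands die on `M ∖ (S ∪ S')`.
[cite: VoisinHodgeI2002, §11.1.2 (classes of cycles `∑ nᵢ Zᵢ`, Def. 11.17)] -/
theorem IsAnalyticallySupported.add {A : HodgeModel n X} {p k : ℕ} {c c' : complexBetti X k}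
    (hc : IsAnalyticallySupported A p c) (hc' : IsAnalyticallySupported A p c') :
    IsAnalyticallySupported A p (c + c') := by
  obtain ⟨S, ⟨hS, hSp⟩, hcS⟩ := hc
  obtain ⟨S', ⟨hS', hS'p⟩, hcS'⟩ := hc'
  refine ⟨S ∪ S', ⟨hS.union hS', forall_regularLocus_union_le hS hS' hSp hS'p⟩, ?_⟩
  rw [map_add, map_add, A.map_compl_eq_zero_of_subset subset_union_left _ hcS,
    A.map_compl_eq_zero_of_subset subset_union_right _ hcS', add_zero]

/-- The **submodule of classes analytically supported in codimension `≥ p`** of `Hᵏ(X(ℂ); ℂ)`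
(with respect to the Hodge model `A`): the analytic counterpart of `supportedClasses X k p`.
[cite: VoisinHodgeI2002, §11.1.2] [cite: GrothendieckTopology1969, §1] -/
def analyticallySupportedClasses (A : HodgeModel n X) (p k : ℕ) : Submodule ℂ (complexBetti X k) where
  carrier := {c | IsAnalyticallySupported A p c}
  add_mem' hc hc' := hc.add hc'
  zero_mem' := IsAnalyticallySupported.zero A p k
  smul_mem' a _ hc := hc.smul a

/-- Membership in `analyticallySupportedClasses` is `IsAnalyticallySupported` (by `Iff.rfl`).
[cite: VoisinHodgeI2002, §11.1.2] -/
@[simp]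
theorem mem_analyticallySupportedClasses_iff {A : HodgeModel n X} {p k : ℕ} {c : complexBetti X k} :
    c ∈ analyticallySupportedClasses A p k ↔ IsAnalyticallySupported A p c :=
  Iff.rfl

/-- The submodules `analyticallySupportedClasses A p k` decrease with `p`.
[cite: GrothendieckTopology1969, §1] -/
theorem analyticallySupportedClasses_anti (A : HodgeModel n X) (k : ℕ) {p p' : ℕ} (hp : p' ≤ p) :
    analyticallySupportedClasses A p k ≤ analyticallySupportedClasses A p' k :=
  fun _ hc => IsAnalyticallySupported.anti hp hc

/-- Finite sums of analytically supported classes are analytically supported.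
[cite: VoisinHodgeI2002, §11.1.2 (Def. 11.17)] -/
theorem IsAnalyticallySupported.sum {A : HodgeModel n X} {p k : ℕ} {ι : Type*} (s : Finset ι)
    {c : ι → complexBetti X k} (h : ∀ i ∈ s, IsAnalyticallySupported A p (c i)) :
    IsAnalyticallySupported A p (∑ i ∈ s, c i) :=
  Submodule.sum_mem (analyticallySupportedClasses A p k) h

/-! ### Codimension `0`, and the `p = 1` dictionary with `S ≠ univ` -/

/-- **In codimension `0` every class is analytically supported**: take `S = M`, whose complement is
empty, so that `Hᵏ(M ∖ S; ℂ) = 0` (the analogue of `supportedClasses_zero`).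
[cite: GrothendieckTopology1969, §1] -/
theorem isAnalyticallySupported_zero_left (A : HodgeModel n X) {k : ℕ} (c : complexBetti X k) :
    IsAnalyticallySupported A 0 c := by
  refine ⟨univ, ⟨isAnalyticSet_univ, fun _ _ q _ => Nat.zero_le q⟩, ?_⟩
  haveI : IsEmpty {x : A.carrier // x ∉ (univ : Set A.carrier)} := ⟨fun x => x.2 (mem_univ _)⟩
  haveI := ModuleCat.subsingleton_of_isZero
    (Motives.isZero_singularCohomology_of_isEmpty ℂ ℂ
      (E := {x : A.carrier // x ∉ (univ : Set A.carrier)}) k)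
  exact Subsingleton.elim _ _

/-- A support of codimension `≥ 1` (more generally `≥ p` with `0 < p`) is a PROPER subset of a
non-empty model: every point of `M` is a regular point of codimension `0` of `univ`.
[cite: VoisinHodgeI2002, §11.1.1] -/
theorem IsAnalyticallySupported.exists_ne_univ {A : HodgeModel n X} [Nonempty A.carrier] {p k : ℕ}
    (hp : 0 < p) {c : complexBetti X k} (h : IsAnalyticallySupported A p c) :
    ∃ S : Set A.carrier, IsAnalyticSet 𝓘(ℂ, A.model) S ∧ S ≠ univ ∧
      singularCohomology.map ℂ ℂ
        (⟨Subtype.val, continuous_subtype_val⟩ : C({x : A.carrier // x ∉ S}, A.carrier)) k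
        (A.pullback k c) = 0 := by
  obtain ⟨S, ⟨hS, hSp⟩, hcS⟩ := h
  exact ⟨S, hS, ne_univ_of_forall_regularLocus_le hp hSp, hcS⟩

/-- Conversely, on a CONNECTED model a class dying off a proper closed analytic subset `S ≠ M` is
analytically supported in codimension `≥ 1`: a regular point of codimension `0` would be an
interior point of `S`, and proper analytic subsets of connected complex manifolds have empty
interior (`IsAnalyticSet.one_le_of_ne_univ`, identity theorem). This is the passage from the
hypothesis of `lefschetzOneOne_rational_of` (`S ≠ univ`) to the present phrasing.
[cite: Chirka1989, §2.2 Prop. 1 and Corollary] -/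
theorem isAnalyticallySupported_of_ne_univ {A : HodgeModel n X} [ConnectedSpace A.carrier] {k : ℕ}
    {c : complexBetti X k} {S : Set A.carrier} (hS : IsAnalyticSet 𝓘(ℂ, A.model) S)
    (hSne : S ≠ univ)
    (hcS : singularCohomology.map ℂ ℂ
      (⟨Subtype.val, continuous_subtype_val⟩ : C({x : A.carrier // x ∉ S}, A.carrier)) k
      (A.pullback k c) = 0) :
    IsAnalyticallySupported A 1 c :=
  ⟨S, ⟨hS, hS.one_le_of_ne_univ hSne⟩, hcS⟩

/-- **The `p = 1` dictionary.** On a non-empty connected model (e.g. the Hodge model of a smooth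
projective variety, `HodgeModel.connectedSpace_carrier`), a class is analytically supported in
codimension `≥ 1` iff it dies off some proper closed analytic subset — the hypothesis of
`lefschetzOneOne_rational_of`. [cite: VoisinHodgeI2002, §11.1.2 and Cor. 11.34 (proof)] -/
theorem isAnalyticallySupported_one_iff {A : HodgeModel n X} [ConnectedSpace A.carrier] {k : ℕ}
    (c : complexBetti X k) :
    IsAnalyticallySupported A 1 c ↔
      ∃ S : Set A.carrier, IsAnalyticSet 𝓘(ℂ, A.model) S ∧ S ≠ univ ∧
        singularCohomology.map ℂ ℂ
          (⟨Subtype.val, continuous_subtype_val⟩ : C({x : A.carrier // x ∉ S}, A.carrier)) k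
          (A.pullback k c) = 0 :=
  ⟨fun h => h.exists_ne_univ Nat.one_pos, fun ⟨_, hS, hSne, hcS⟩ =>
    isAnalyticallySupported_of_ne_univ hS hSne hcS⟩

/-! ### Chow + GAGA: analytically supported classes are algebraically supported -/

/-- **Analytically supported ⟹ algebraically supported (Chow + GAGA).** Let `X` be smooth
projective of dimension `n` over `ℂ`, `A` a Hodge model, and `c ∈ Hᵏ(X(ℂ); ℂ)` analytically
supported in codimension `≥ p`, on the closed analytic subset `S ⊆ M`. By Chow's theorem for
analytifications (`chow_analyticSet_analytification_holds`; Serre, GAGA §19 Prop. 13 with §5;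
Chow 1949 Thm. V) `S = φ⁻¹(Z(ℂ))` for a Zariski-closed `Z ⊆ X`; by the GAGA comparison of
dimensions (hypothesis `hgaga : gaga_le_coheight_of_regularLocus_codim`, GAGA §6 Prop. 3
Cor. 2–3) every point of `Z` has codimension `≥ p`; and `c` dies on `(X ∖ Z)(ℂ) ≃ M ∖ S`
(`restrictCompl_eq_zero_of_pullback`), so `c ∈ Nᵖ Hᵏ(X(ℂ); ℂ) = supportedClasses X k p`
(`mem_supportedClasses_of_restrictCompl_eq_zero`). For `p = 1` this is the glue proved in
`lefschetzOneOne_rational_of` (where GAGA §6 is replaced by "proper closed subsets of an integral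
scheme have codimension `≥ 1`"). [cite: SerreGAGA1956, §19 Prop. 13, §5 and §6 Prop. 3 Cor. 2–3]
[cite: Chow1949, Thm. V] -/
theorem IsAnalyticallySupported.mem_supportedClasses (hgaga : gaga_le_coheight_of_regularLocus_codim)
    (hX : Motives.IsSmoothProjective n X) {A : HodgeModel n X} {p k : ℕ} {c : complexBetti X k}
    (h : IsAnalyticallySupported A p c) : c ∈ supportedClasses X k p := by
  obtain ⟨S, ⟨hS, hSp⟩, hcS⟩ := h
  -- Chow: `S = φ⁻¹(Z(ℂ))` with `Z` Zariski-closed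
  obtain ⟨Z, hZc, hSZ⟩ := chow_analyticSet_analytification_holds hX A.isAnalytification S hS
  -- GAGA: `Z` has codimension `≥ p` at every scheme point
  have hcodim : ∀ z ∈ Z, (p : ℕ∞) ≤ Order.coheight z := by
    refine hgaga hX A.isAnalytification p Z hZc ?_
    rw [← hSZ]
    exact hSp
  -- transport of the vanishing and conclusion
  exact mem_supportedClasses_of_restrictCompl_eq_zero hZc hcodim
    (restrictCompl_eq_zero_of_pullback A hSZ c hcS)

/-- **Analytically supported classes in degree `2p` are algebraic** (Chow + GAGA), for `X` smooth
projective, conditional on the GAGA dimension comparison `gaga_le_coheight_of_regularLocus_codim`: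
`IsAnalyticallySupported A p c → c ∈ algebraicClasses X p = Nᵖ H²ᵖ(X(ℂ); ℂ)`. Up to that
hypothesis this is the route item `AnalyticSupportAlgebraic` of `HolomorphicityRate`.
[cite: SerreGAGA1956, §19 Prop. 13 and §6 Prop. 3 Cor. 2–3] [cite: Chow1949, Thm. V] -/
theorem IsAnalyticallySupported.mem_algebraicClasses (hgaga : gaga_le_coheight_of_regularLocus_codim)
    (hX : Motives.IsSmoothProjective n X) {A : HodgeModel n X} {p : ℕ} {c : complexBetti X (2 * p)}
    (h : IsAnalyticallySupported A p c) : c ∈ algebraicClasses X p :=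
  h.mem_supportedClasses hgaga hX

/-- Submodule form: `analyticallySupportedClasses A p k ≤ supportedClasses X k p = Nᵖ Hᵏ` for `X`
smooth projective, conditional on `gaga_le_coheight_of_regularLocus_codim`.
[cite: SerreGAGA1956, §19 Prop. 13 and §6 Prop. 3 Cor. 2–3] -/
theorem analyticallySupportedClasses_le_supportedClasses
    (hgaga : gaga_le_coheight_of_regularLocus_codim) (hX : Motives.IsSmoothProjective n X)
    (A : HodgeModel n X) (p k : ℕ) : analyticallySupportedClasses A p k ≤ supportedClasses X k p :=
  fun _ hc => IsAnalyticallySupported.mem_supportedClasses hgaga hX hc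

/-- For `X` smooth projective the model is connected and non-empty, so the `p = 1` dictionary
`isAnalyticallySupported_one_iff` applies unconditionally: a class is analytically supported in
codimension `≥ 1` iff it dies off a proper closed analytic subset of `X^an` (the hypothesis shape
of `lefschetzOneOne_rational_of`). [cite: VoisinHodgeI2002, §11.1.2 and Cor. 11.34 (proof)] -/
theorem isAnalyticallySupported_one_iff_of_isSmoothProjective (hX : Motives.IsSmoothProjective n X)
    (A : HodgeModel n X) {k : ℕ} (c : complexBetti X k) :
    IsAnalyticallySupported A 1 c ↔
      ∃ S : Set A.carrier, IsAnalyticSet 𝓘(ℂ, A.model) S ∧ S ≠ univ ∧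
        singularCohomology.map ℂ ℂ
          (⟨Subtype.val, continuous_subtype_val⟩ : C({x : A.carrier // x ∉ S}, A.carrier)) k
          (A.pullback k c) = 0 :=
  haveI := A.connectedSpace_carrier hX
  isAnalyticallySupported_one_iff c

/-! ### Independence of the Hodge model -/

/-- **Transport along a biholomorphism over `X(ℂ)`.** If `h : A.carrier ≃ₜ A'.carrier` is
holomorphic with holomorphic inverse and commutes with the comparison maps
(`A'.toComplexPoints ∘ h = A.toComplexPoints`), then a class analytically supported with respect to
`A'`, on `S'`, is analytically supported with respect to `A`, on `h ⁻¹' S'`: analyticity pulls back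
(`IsAnalyticSet.preimage`), lower bounds on the codimension at regular points are invariant under
biholomorphisms (`forall_regularLocus_preimage_le`), and `A.pullback = h^* ∘ A'.pullback`
(`HodgeModel.pullback_eq_map_pullback`) with `h` restricting to `M ∖ h⁻¹(S') → M' ∖ S'`.
[cite: SerreGAGA1956, §2 n°5 Prop. 2 (unicité de X^h)] -/
theorem IsAnalyticallySupported.of_biholomorph {A A' : HodgeModel n X}
    (h : A.carrier ≃ₜ A'.carrier) (hh : MDifferentiable 𝓘(ℂ, A.model) 𝓘(ℂ, A'.model) h)
    (hh' : MDifferentiable 𝓘(ℂ, A'.model) 𝓘(ℂ, A.model) h.symm)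
    (hcomm : A'.toComplexPoints ∘ h = A.toComplexPoints) {p k : ℕ} {c : complexBetti X k}
    (hc : IsAnalyticallySupported A' p c) : IsAnalyticallySupported A p c := by
  obtain ⟨S', ⟨hS', hS'p⟩, hcS'⟩ := hc
  refine ⟨h ⁻¹' S', ⟨hS'.preimage hh, forall_regularLocus_preimage_le h hh hh' hS'p⟩, ?_⟩
  -- `h` restricted to the complements
  let j : C({x : A.carrier // x ∉ h ⁻¹' S'}, {x' : A'.carrier // x' ∉ S'}) :=
    ⟨fun x => ⟨h x.1, x.2⟩, (h.continuous.comp continuous_subtype_val).subtype_mk _⟩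
  have hsq : (⟨Subtype.val, continuous_subtype_val⟩ :
        C({x' : A'.carrier // x' ∉ S'}, A'.carrier)).comp j =
      (⟨h, h.continuous⟩ : C(A.carrier, A'.carrier)).comp
        (⟨Subtype.val, continuous_subtype_val⟩ : C({x : A.carrier // x ∉ h ⁻¹' S'}, A.carrier)) := by
    ext x
    rfl
  rw [HodgeModel.pullback_eq_map_pullback A A' h hcomm k c]
  change (singularCohomology.map ℂ ℂ (⟨h, h.continuous⟩ : C(A.carrier, A'.carrier)) k ≫
    singularCohomology.map ℂ ℂ
      (⟨Subtype.val, continuous_subtype_val⟩ : C({x : A.carrier // x ∉ h ⁻¹' S'}, A.carrier)) k)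
      (A'.pullback k c) = 0
  rw [← singularCohomology.map_comp, ← hsq, singularCohomology.map_comp]
  change singularCohomology.map ℂ ℂ j k (singularCohomology.map ℂ ℂ
    (⟨Subtype.val, continuous_subtype_val⟩ : C({x' : A'.carrier // x' ∉ S'}, A'.carrier)) k
      (A'.pullback k c)) = 0
  rw [hcS', map_zero]

/-- **Independence of the Hodge model.** For `X` smooth projective, whether a class is analytically
supported in codimension `≥ p` does not depend on the Hodge model: two Hodge models of `X` are
biholomorphic over `X(ℂ)` (`HodgeModel.exists_biholomorph`, the uniqueness of the analytification,
Serre GAGA §2 n°5 Prop. 2, proved in the tree as `IsAnalytification.unique_holds`), and the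
predicate transports along such biholomorphisms (`IsAnalyticallySupported.of_biholomorph`).
[cite: SerreGAGA1956, §2 n°5 Prop. 2 (unicité de X^h)] -/
theorem isAnalyticallySupported_independent_of_hodgeModel (hX : Motives.IsSmoothProjective n X)
    (A A' : HodgeModel n X) {p k : ℕ} (c : complexBetti X k) :
    IsAnalyticallySupported A p c ↔ IsAnalyticallySupported A' p c := by
  constructor
  · intro hc
    obtain ⟨h, hh, hh', hcomm⟩ := HodgeModel.exists_biholomorph hX A' A
    exact hc.of_biholomorph h hh hh' hcomm
  · intro hc
    obtain ⟨h, hh, hh', hcomm⟩ := HodgeModel.exists_biholomorph hX A A'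
    exact hc.of_biholomorph h hh hh' hcomm

/-- Submodule form of the independence of the Hodge model (`X` smooth projective).
[cite: SerreGAGA1956, §2 n°5 Prop. 2 (unicité de X^h)] -/
theorem analyticallySupportedClasses_independent_of_hodgeModel
    (hX : Motives.IsSmoothProjective n X) (A A' : HodgeModel n X) (p k : ℕ) :
    analyticallySupportedClasses A p k = analyticallySupportedClasses A' p k :=
  Submodule.ext fun c => isAnalyticallySupported_independent_of_hodgeModel hX A A' c

end HodgeTheory

end Literature.AlgebraicGeometry.HodgeTheory

end
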